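import Mathlib
import Literature.NumberTheory.Irrationality.Lai2025TwoAdic.GeneralTwoAdicValuation
import Literature.NumberTheory.Irrationality.PAdicZetaValues.Criterion
import Literature.NumberTheory.Irrationality.PAdicZetaValues.Hurwitz
import Literature.NumberTheory.Transcendental.ZetaLinearFormsCriterion
import HarnessLib

/-!
# Lai 2025 (IJNT), Theorem 1.3 for GENERAL `s`: one of `ζ₂(j, ¼)`, `j ∈ [s+3, 2s+3]`, is irrational — PROVED
# (discharge of the named fact `PAdicZetaValues.lai2025TwoAdic_theorem13`)

Topic `Literature/NumberTheory/Irrationality/Lai2025TwoAdic`.  Source: L. Lai, *On the irrationality of certain `2`-adic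
zeta values*, Int. J. Number Theory (2025) = arXiv:2304.00816 [Lai2025TwoAdicZeta], Theorem 1.3 and §7 (its proof)
(held text `paper:arxiv-2304.00816`, chunks p0002, p0013, read on the page).  PROOF FILE (theorems + two plumbing
definitions with bodies; no named fact; net debt −1: it discharges `PAdicZetaValues.lai2025TwoAdic_theorem13`).
File 4 (last) of the general-`s` discharge; inputs: `GeneralLinearFormsT.lean` (Lemma 3.3: `Ts_eq`; Lemmas 4.5–4.6:
`exists_int_lcm_pow_mul_sigmaZero`, `exists_int_lcm_pow_mul_sigmaI'`; Lemma 5.2: `abs_sigmaZero_le`, `abs_sigmaI_le`),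
`GeneralTwoAdicValuation.lean` (Lemma 6.3: `Ts_mersenne_ne_zero`, `norm_Ts_mersenne_le`), the tree's Lemma 2.1
(`PAdicZetaValues.exists_isIrrational_of_linearForms`) and prime number theorem bound
(`Transcendental.eventually_lcmUpto_mul_pow_le_exp`: `d_n^k ≤ e^{(k+ε)n}`).

## Source, as printed ([Lai2025TwoAdicZeta, Thm 1.3 and §7])

**Theorem 1.3.** «For any nonnegative integer `s`, the following set contains at least one irrational number:
`{ζ₂(j, 1/4) | j ∈ ℤ ∩ [s+3, 2s+3]}`.»

*Proof of Theorem 1.3 (§7).* «By Lemma 3.3, Lemma 4.5 and Lemma 4.6, we have: for any `n > (s+2)²`, `d_n^{2s+3}T_n` is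
a linear combination of `1, ζ₂(s+3,¼), ζ₂(s+4,¼), …, ζ₂(2s+3,¼)` with integer coefficients:
`d_n^{2s+3}T_n = d_n^{2s+3}σ_{n,0} + Σ_{i=2}^{s+2} d_n^{2s+3}σ_{n,i}·ζ₂(i+s+1, ¼)`.  When `n` belongs to `{2^m − 1 | m ∈ ℕ}`,
by (d_n_est), Lemma 5.2 and Lemma 6.3 we have
`max_{i=0,2,3,…,s+2} |d_n^{2s+3}σ_{n,i}| · |d_n^{2s+3}σ_{n,0} + Σ_{i=2}^{s+2} d_n^{2s+3}σ_{n,i}ζ₂(i+s+1,¼)|₂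
 ≤ 8^{(s+2)n+o(n)} · exp((2s+3)n + o(n)) · 2^{−(6s+12+o(1))n} = exp((2s+3 − (3s+6)log 2 + o(1))n) → 0` as `n = 2^m−1`,
`m → +∞` (because `3log 2 = 2.079… > 2`), and importantly `d_n^{2s+3}T_n ≠ 0`.  By Lemma 2.1, there is at least one
irrational number among `ζ₂(s+3,¼), ζ₂(s+4,¼), …, ζ₂(2s+3,¼)`.»

## What is formalised (all PROVED)

* `xiVec s` = the vector `(1, ζ₂(i+s+1,¼))_{i ∈ [2,s+2]}` indexed by `Option [2,s+2]`, `coefVec s n` = the coefficients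
  `d_n^{2s+3}σ_{n,0}`, `d_n^{2s+3}σ_{n,i}`; `linearFormS_eq` (the displayed identity `= d_n^{2s+3}T_n`),
  `exists_int_coefVec` (integrality, Lemmas 4.5–4.6), `abs_coefVec_le` (Lemma 5.2 with `d_n^{2s+3}`),
  `norm_linearFormS_mersenne_le` and `linearFormS_mersenne_ne_zero` (Lemma 6.3 along `n = 2^m − 1`, `m ≥ 2`).
* `tendsto_boundFun` — the displayed estimate: `max_i|d_n^{2s+3}σ_{n,i}| · ‖d_n^{2s+3}T_n‖₂ → 0` along `n = 2^m−1`
  (prime number theorem `d_n^{2s+3} ≤ e^{(2s+3.5)n}`, `2s + 4 ≤ (3s+6)log 2` from Mathlib's `Real.log_two_gt_d9`, and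
  `(n+1)^{3s+7}e^{−n/2} → 0`).
* **Theorem 1.3**: `exists_isIrrational_window` and the discharge
  `PAdicZetaValues.lai2025TwoAdic_theorem13_holds : lai2025TwoAdic_theorem13`.

Cell zeta5-irr / pub-zeta5 (HONEST FRAMING: systematic search; no irrationality claim unless kernel-certified): this is a
kernel-checked proof of a PUBLISHED `2`-adic irrationality theorem [Lai2025TwoAdicZeta, Thm 1.3]; nothing here bears on
`ζ(5) ∈ ℝ`.
-/

noncomputable section

open Finset Filter Topology
open Literature.NumberTheory.LocalFields
open Literature.NumberTheory.Irrationality.PAdicZetaValues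
open Literature.NumberTheory.Transcendental
open scoped Nat

namespace Literature.NumberTheory.Irrationality.Lai2025TwoAdic

/-! ## §1. The integer linear forms `d_n^{2s+3}T_n = d_n^{2s+3}σ_{n,0} + Σ_{i=2}^{s+2} d_n^{2s+3}σ_{n,i}ζ₂(i+s+1,¼)` -/

/-- The vector `(1, ζ₂(i+s+1, ¼))_{i ∈ [2, s+2]}` of Theorem 1.3 / Lemma 2.1, indexed by `Option [2,s+2]` (`none ↦ 1`).
[cite: Lai2025TwoAdicZeta, §7 (proof of Thm 1.3: "a linear combination of 1, ζ₂(s+3,¼), …, ζ₂(2s+3,¼)")] -/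
def xiVec (s : ℕ) : Option (Icc 2 (s + 2)) → ℚ_[2]
  | none => 1
  | some i => padicHurwitzZeta 2 ((i : ℕ) + s + 1) (4 : ℚ_[2])⁻¹

/-- The coefficients `d_n^{2s+3}σ_{n,0}` (`none`) and `d_n^{2s+3}σ_{n,i}` (`some i`). [cite: Lai2025TwoAdicZeta, §7 (proof of Thm 1.3, the displayed identity)] -/
def coefVec (s n : ℕ) : Option (Icc 2 (s + 2)) → ℚ
  | none => (Nat.lcmUpto n : ℚ) ^ (2 * s + 3) * sigmaZero s n
  | some i => (Nat.lcmUpto n : ℚ) ^ (2 * s + 3) * sigmaI s n i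

/-- **The linear form** (Lemma 3.3 times `d_n^{2s+3}`):
`d_n^{2s+3}σ_{n,0} + Σ_{i=2}^{s+2} d_n^{2s+3}σ_{n,i}·ζ₂(i+s+1,¼) = d_n^{2s+3}·T_n` in `ℚ₂`.
[cite: Lai2025TwoAdicZeta, §7 (proof of Thm 1.3, the displayed identity) with Lemma 3.3] -/
theorem linearFormS_eq (s n : ℕ) :
    ∑ o, ((coefVec s n o : ℚ) : ℚ_[2]) * xiVec s o = ((Nat.lcmUpto n : ℚ) : ℚ_[2]) ^ (2 * s + 3) * Ts s n := by
  rw [Fintype.sum_option]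
  simp only [coefVec, xiVec, mul_one]
  rw [Finset.sum_coe_sort (Icc 2 (s + 2)) (fun i : ℕ =>
    ((((Nat.lcmUpto n : ℚ) ^ (2 * s + 3) * sigmaI s n i : ℚ)) : ℚ_[2]) *
      padicHurwitzZeta 2 (i + s + 1) (4 : ℚ_[2])⁻¹), Ts_eq]
  push_cast
  rw [mul_add, mul_sum]
  congr 1
  exact sum_congr rfl fun i _ => by ring

/-- **Integrality** (Lemmas 4.5, 4.6): every coefficient `d_n^{2s+3}σ_{n,i}` is an integer. [cite: Lai2025TwoAdicZeta, §7 (proof of Thm 1.3: "with integer coefficients"), Lemmas 4.5–4.6] -/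
theorem exists_int_coefVec (s n : ℕ) (o : Option (Icc 2 (s + 2))) : ∃ z : ℤ, coefVec s n o = z := by
  cases o with
  | none => exact exists_int_lcm_pow_mul_sigmaZero s n
  | some i => exact exists_int_lcm_pow_mul_sigmaI' s n i

/-- **The Archimedean sizes** ((d_n_est) is used later; here Lemma 5.2 times `d_n^{2s+3}`):
`|d_n^{2s+3}σ_{n,i}| ≤ d_n^{2s+3}·K(s)(n+1)^{s+4}2^{(3s+6)n}` (in `ℝ`). [cite: Lai2025TwoAdicZeta, §7 (proof of Thm 1.3) with Lemma 5.2 (sigma_est)] -/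
theorem abs_coefVec_le (s n : ℕ) (o : Option (Icc 2 (s + 2))) :
    |((coefVec s n o : ℚ) : ℝ)| ≤
      (Nat.lcmUpto n : ℝ) ^ (2 * s + 3) * ((Ksig s : ℝ) * ((n : ℝ) + 1) ^ (s + 4) * (2 : ℝ) ^ ((3 * s + 6) * n)) := by
  have hq : |coefVec s n o| ≤
      (Nat.lcmUpto n : ℚ) ^ (2 * s + 3) * (Ksig s * ((n : ℚ) + 1) ^ (s + 4) * (2 : ℚ) ^ ((3 * s + 6) * n)) := by
    have hd : (0 : ℚ) ≤ (Nat.lcmUpto n : ℚ) ^ (2 * s + 3) := by positivity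
    cases o with
    | none =>
      rw [coefVec, abs_mul, abs_of_nonneg hd]
      exact mul_le_mul_of_nonneg_left (abs_sigmaZero_le s n) hd
    | some i =>
      rw [coefVec, abs_mul, abs_of_nonneg hd]
      refine mul_le_mul_of_nonneg_left (abs_sigmaI_le s n ?_) hd
      have := mem_Icc.1 i.2
      rw [mem_Icc]; omega
  have h := (Rat.cast_le (K := ℝ)).2 hq
  rw [Rat.cast_abs] at h
  refine h.trans (le_of_eq ?_)
  push_cast; ring

/-- **The `2`-adic size** along `n = 2^m − 1` (`m ≥ 2`): `‖d_n^{2s+3}T_n‖₂ ≤ ‖T_n‖₂ ≤ 2^{(2s+3)m − (6s+12)n − 3s − 4}`.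
[cite: Lai2025TwoAdicZeta, §7 (proof of Thm 1.3) with Lemma 6.3] -/
theorem norm_linearFormS_mersenne_le (s : ℕ) {m : ℕ} (hm : 2 ≤ m) :
    ‖∑ o, ((coefVec s (2 ^ m - 1) o : ℚ) : ℚ_[2]) * xiVec s o‖ ≤
      (2 : ℝ) ^ ((2 * s + 3) * (m : ℤ) - (6 * s + 12) * ((2 ^ m - 1 : ℕ) : ℤ) - 3 * s - 4) := by
  rw [linearFormS_eq, norm_mul, norm_pow]
  have hd : ‖((Nat.lcmUpto (2 ^ m - 1) : ℚ) : ℚ_[2])‖ ≤ 1 := by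
    have := Padic.norm_int_le_one (p := 2) (Nat.lcmUpto (2 ^ m - 1) : ℤ)
    push_cast at this ⊢
    exact this
  calc ‖((Nat.lcmUpto (2 ^ m - 1) : ℚ) : ℚ_[2])‖ ^ (2 * s + 3) * ‖Ts s (2 ^ m - 1)‖
      ≤ 1 ^ (2 * s + 3) * (2 : ℝ) ^ ((2 * s + 3) * (m : ℤ) - (6 * s + 12) * ((2 ^ m - 1 : ℕ) : ℤ) - 3 * s - 4) :=
        mul_le_mul (pow_le_pow_left₀ (norm_nonneg _) hd _) (norm_Ts_mersenne_le s hm) (norm_nonneg _) (by positivity)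
    _ = _ := by rw [one_pow, one_mul]

/-- **Non-vanishing** along `n = 2^m − 1` (`m ≥ 2`) («and importantly `d_n^{2s+3}T_n ≠ 0`»). [cite: Lai2025TwoAdicZeta, §7 (proof of Thm 1.3) with Lemma 6.3] -/
theorem linearFormS_mersenne_ne_zero (s : ℕ) {m : ℕ} (hm : 2 ≤ m) :
    ∑ o, ((coefVec s (2 ^ m - 1) o : ℚ) : ℚ_[2]) * xiVec s o ≠ 0 := by
  rw [linearFormS_eq]
  refine mul_ne_zero (pow_ne_zero _ ?_) (Ts_mersenne_ne_zero s hm)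
  exact_mod_cast (Nat.lcmUpto_pos (2 ^ m - 1)).ne'

/-! ## §2. The sizes multiply to `o(1)` along `n = 2^m − 1` -/

/-- `n_m := 2^m − 1 → ∞`. [folklore] -/
private theorem tendsto_mersenne : Tendsto (fun m : ℕ => 2 ^ m - 1) atTop atTop := by
  refine tendsto_atTop_mono (fun m => ?_) tendsto_id
  have : m < 2 ^ m := Nat.lt_two_pow_self
  show m ≤ 2 ^ m - 1
  omega

/-- `K(s)(n+1)^{3s+7}e^{−n/2} → 0`. [cite: Lai2025TwoAdicZeta, §7 (proof of Thm 1.3: "→ 0 as n = 2^m−1, m → +∞")] -/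
theorem tendsto_poly_exp (s : ℕ) :
    Tendsto (fun n : ℕ => (Ksig s : ℝ) * ((n : ℝ) + 1) ^ (3 * s + 7) * Real.exp (-(n : ℝ) / 2)) atTop (𝓝 0) := by
  have hx : Tendsto (fun n : ℕ => ((n : ℝ) + 1) / 2) atTop atTop :=
    (tendsto_atTop_add_const_right atTop (1 : ℝ) tendsto_natCast_atTop_atTop).atTop_div_const (by norm_num)
  have h := (Real.tendsto_pow_mul_exp_neg_atTop_nhds_zero (3 * s + 7)).comp hx
  have h' := h.const_mul ((Ksig s : ℝ) * 2 ^ (3 * s + 7) * Real.exp (1 / 2))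
  rw [mul_zero] at h'
  refine h'.congr fun n => ?_
  simp only [Function.comp_def]
  rw [div_pow, show Real.exp (-(n : ℝ) / 2) = Real.exp (1 / 2) * Real.exp (-(((n : ℝ) + 1) / 2)) by
    rw [← Real.exp_add]; congr 1; ring]
  field_simp

/-- The exponential comparison «`2s+3 − (3s+6)log 2 < 0` (because `3 log 2 = 2.079… > 2`)», with room `½ + ½`:
`e^{(2s+3+½)n}·2^{(3s+6)n}·2^{−(6s+12)n} ≤ e^{−n/2}`. [cite: Lai2025TwoAdicZeta, §7 (proof of Thm 1.3: "because … 3 − 6 log 2 < 0")] -/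
theorem exp_mul_two_pow_le (s n : ℕ) :
    Real.exp ((2 * s + 3 + 1 / 2) * n) * (2 : ℝ) ^ ((3 * s + 6) * n) * (2 : ℝ) ^ (-(((6 * s + 12) * n : ℕ) : ℤ)) ≤
      Real.exp (-(n : ℝ) / 2) := by
  have hlog := Real.log_two_gt_d9
  have hn : (0 : ℝ) ≤ n := Nat.cast_nonneg n
  have hs : (0 : ℝ) ≤ s := Nat.cast_nonneg s
  have h1 : (2 : ℝ) ^ ((3 * s + 6) * n) = Real.exp (((3 * s + 6) * n : ℕ) * Real.log 2) := by
    rw [← Real.exp_log (by positivity : (0 : ℝ) < 2 ^ ((3 * s + 6) * n)), Real.log_pow]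
  have h2 : (2 : ℝ) ^ (-(((6 * s + 12) * n : ℕ) : ℤ)) = Real.exp (-(((6 * s + 12) * n : ℕ) * Real.log 2)) := by
    rw [zpow_neg, zpow_natCast, ← Real.exp_log (by positivity : (0 : ℝ) < 2 ^ ((6 * s + 12) * n)), Real.log_pow,
      ← Real.exp_neg]
  rw [h1, h2, ← Real.exp_add, ← Real.exp_add]
  refine Real.exp_le_exp.2 ?_
  push_cast
  have h23 : (2 : ℝ) ≤ 3 * Real.log 2 := by linarith
  nlinarith [mul_nonneg (mul_nonneg hn (by positivity : (0 : ℝ) ≤ s + 2)) (sub_nonneg.2 h23)]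

/-- The bound function along `n = 2^m − 1`: `d_n^{2s+3}·K(s)(n+1)^{s+4}2^{(3s+6)n} · 2^{(2s+3)m − (6s+12)n − 3s − 4}`.
[cite: Lai2025TwoAdicZeta, §7 (proof of Thm 1.3, the displayed estimate)] -/
def boundFun (s m : ℕ) : ℝ :=
  (Nat.lcmUpto (2 ^ m - 1) : ℝ) ^ (2 * s + 3) *
    ((Ksig s : ℝ) * (((2 ^ m - 1 : ℕ) : ℝ) + 1) ^ (s + 4) * (2 : ℝ) ^ ((3 * s + 6) * (2 ^ m - 1))) *
    (2 : ℝ) ^ ((2 * s + 3) * (m : ℤ) - (6 * s + 12) * ((2 ^ m - 1 : ℕ) : ℤ) - 3 * s - 4)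

/-- `K(s) ≥ 0` in `ℝ`. [cite: Lai2025TwoAdicZeta, Lemma 5.2] -/
theorem Ksig_cast_nonneg (s : ℕ) : (0 : ℝ) ≤ (Ksig s : ℝ) := by exact_mod_cast (zero_le_one.trans (one_le_Ksig s))

/-- `boundFun s m ≥ 0`. [cite: Lai2025TwoAdicZeta, §7 (proof of Thm 1.3)] -/
theorem boundFun_nonneg (s m : ℕ) : 0 ≤ boundFun s m := by
  unfold boundFun
  have := Ksig_cast_nonneg s
  exact mul_nonneg (mul_nonneg (by positivity) (mul_nonneg (mul_nonneg this (by positivity)) (by positivity)))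
    (by positivity)

/-- **The sizes multiply to `o(1)`**: `boundFun s m → 0` («`≤ 8^{(s+2)n+o(n)}·e^{(2s+3)n+o(n)}·2^{−(6s+12+o(1))n}
= exp((2s+3−(3s+6)log 2+o(1))n) → 0`»; here: PNT `d_n^{2s+3} ≤ e^{(2s+3.5)n}`, `2^{(2s+3)m} = (n+1)^{2s+3}`, then
`exp_mul_two_pow_le` and `tendsto_poly_exp`). [cite: Lai2025TwoAdicZeta, §7 (proof of Thm 1.3, the displayed estimate)] -/
theorem tendsto_boundFun (s : ℕ) : Tendsto (boundFun s) atTop (𝓝 0) := by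
  -- PNT: `d_n^{2s+3} ≤ e^{(2s+3+½)n}` for large `n`
  have hpnt : ∀ᶠ n : ℕ in atTop, (Nat.lcmUpto n : ℝ) ^ (2 * s + 3) ≤ Real.exp ((2 * s + 3 + 1 / 2) * n) := by
    have h := eventually_lcmUpto_mul_pow_le_exp 1 (2 * s + 3) (ε := 1 / 2) (by norm_num)
    filter_upwards [h] with n hn
    rw [one_mul] at hn
    refine hn.trans (le_of_eq ?_)
    congr 1; push_cast; ring
  have hpnt' := tendsto_mersenne.eventually hpnt
  have hmaj := (tendsto_poly_exp s).comp tendsto_mersenne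
  refine squeeze_zero' (Eventually.of_forall fun m => boundFun_nonneg s m) ?_ hmaj
  filter_upwards [hpnt', eventually_ge_atTop 1] with m hd hm
  simp only [Function.comp_def]
  set n : ℕ := 2 ^ m - 1 with hn
  have hn1 : ((n : ℝ) + 1) = (2 : ℝ) ^ m := by
    rw [hn, Nat.cast_sub Nat.one_le_two_pow]; push_cast; ring
  have hK : (0 : ℝ) ≤ (Ksig s : ℝ) := Ksig_cast_nonneg s
  -- `2^{(2s+3)m − (6s+12)n − 3s − 4} ≤ (n+1)^{2s+3}·2^{−(6s+12)n}`
  have hz : (2 : ℝ) ^ ((2 * s + 3) * (m : ℤ) - (6 * s + 12) * (n : ℤ) - 3 * s - 4) ≤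
      ((n : ℝ) + 1) ^ (2 * s + 3) * (2 : ℝ) ^ (-(((6 * s + 12) * n : ℕ) : ℤ)) := by
    rw [hn1, ← pow_mul, ← zpow_natCast (2 : ℝ) (m * (2 * s + 3)), ← zpow_add₀ two_ne_zero]
    exact zpow_le_zpow_right₀ (by norm_num) (by push_cast; nlinarith)
  unfold boundFun
  calc (Nat.lcmUpto n : ℝ) ^ (2 * s + 3) * ((Ksig s : ℝ) * ((n : ℝ) + 1) ^ (s + 4) * (2 : ℝ) ^ ((3 * s + 6) * n)) *
        (2 : ℝ) ^ ((2 * s + 3) * (m : ℤ) - (6 * s + 12) * (n : ℤ) - 3 * s - 4)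
      ≤ Real.exp ((2 * s + 3 + 1 / 2) * n) * ((Ksig s : ℝ) * ((n : ℝ) + 1) ^ (s + 4) * (2 : ℝ) ^ ((3 * s + 6) * n)) *
        (((n : ℝ) + 1) ^ (2 * s + 3) * (2 : ℝ) ^ (-(((6 * s + 12) * n : ℕ) : ℤ))) := by
        gcongr
    _ = (Ksig s : ℝ) * ((n : ℝ) + 1) ^ (3 * s + 7) *
        (Real.exp ((2 * s + 3 + 1 / 2) * n) * (2 : ℝ) ^ ((3 * s + 6) * n) * (2 : ℝ) ^ (-(((6 * s + 12) * n : ℕ) : ℤ))) := by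
        ring
    _ ≤ (Ksig s : ℝ) * ((n : ℝ) + 1) ^ (3 * s + 7) * Real.exp (-(n : ℝ) / 2) :=
        mul_le_mul_of_nonneg_left (exp_mul_two_pow_le s n) (by positivity)

/-- Each product `|d_n^{2s+3}σ_{n,i}|·‖d_n^{2s+3}T_n‖₂` is at most `boundFun s m` (`n = 2^m − 1`, `m ≥ 2`).
[cite: Lai2025TwoAdicZeta, §7 (proof of Thm 1.3, the displayed estimate)] -/
theorem abs_mul_norm_le_boundFun (s : ℕ) {m : ℕ} (hm : 2 ≤ m) (o : Option (Icc 2 (s + 2))) :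
    |((coefVec s (2 ^ m - 1) o : ℚ) : ℝ)| * ‖∑ o', ((coefVec s (2 ^ m - 1) o' : ℚ) : ℚ_[2]) * xiVec s o'‖ ≤
      boundFun s m := by
  unfold boundFun
  have hK := Ksig_cast_nonneg s
  exact mul_le_mul (abs_coefVec_le s (2 ^ m - 1) o) (norm_linearFormS_mersenne_le s hm) (norm_nonneg _)
    (mul_nonneg (by positivity) (mul_nonneg (mul_nonneg hK (by positivity)) (by positivity)))

/-! ## §3. Theorem 1.3 -/

/-- **Theorem 1.3** (general `s`): some `ζ₂(i+s+1, ¼)`, `i ∈ [2, s+2]`, is irrational — Lemma 2.1 (tree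
`exists_isIrrational_of_linearForms`) applied to the integer forms `d_n^{2s+3}T_n`, `n = 2^m − 1`; the component `1` of
the vector is rational, so the irrational one is a `ζ₂(i+s+1,¼)`. [cite: Lai2025TwoAdicZeta, Thm 1.3 and §7 (its proof)] -/
theorem exists_isIrrational_window (s : ℕ) :
    ∃ i : Icc 2 (s + 2), IsIrrational 2 (padicHurwitzZeta 2 ((i : ℕ) + s + 1) (4 : ℚ_[2])⁻¹) := by
  classical
  have h := exists_isIrrational_of_linearForms (p := 2) (xiVec s) fun ε hε => by
    obtain ⟨m, hm, hm2⟩ :=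
      (((tendsto_boundFun s).eventually (gt_mem_nhds hε)).and (eventually_ge_atTop 2)).exists
    have hint : ∀ o : Option (Icc 2 (s + 2)), ∃ z : ℤ, coefVec s (2 ^ m - 1) o = z :=
      fun o => exists_int_coefVec s (2 ^ m - 1) o
    choose z hz using hint
    have e : ∑ o, ((z o : ℤ) : ℚ_[2]) * xiVec s o = ∑ o, ((coefVec s (2 ^ m - 1) o : ℚ) : ℚ_[2]) * xiVec s o :=
      Fintype.sum_congr _ _ fun o => by rw [hz o]; push_cast; rfl
    refine ⟨z, ?_, fun o => ?_⟩
    · rw [e]; exact linearFormS_mersenne_ne_zero s hm2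
    · rw [e]
      have habs : (|z o| : ℝ) = |((coefVec s (2 ^ m - 1) o : ℚ) : ℝ)| := by
        rw [hz o]; push_cast; rfl
      rw [habs]
      exact (abs_mul_norm_le_boundFun s hm2 o).trans_lt hm
  obtain ⟨o, ho⟩ := h
  cases o with
  | none =>
    exfalso
    have : ¬ IsIrrational 2 (((1 : ℚ)) : ℚ_[2]) := not_isIrrational_ratCast (p := 2) 1
    exact this (by simpa [xiVec] using ho)
  | some i => exact ⟨i, ho⟩

end Literature.NumberTheory.Irrationality.Lai2025TwoAdic

namespace Literature.NumberTheory.Irrationality.PAdicZetaValues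

open Literature.NumberTheory.Irrationality.Lai2025TwoAdic

/-- **Lai 2025 (2-adic), Theorem 1.3, PROVED** — discharge of the named fact `lai2025TwoAdic_theorem13`: «For any
nonnegative integer `s`, the following set contains at least one irrational number: `{ζ₂(j, ¼) | j ∈ ℤ ∩ [s+3, 2s+3]}`»
(`ζ₂(j,¼)` = the tree's `padicHurwitzZeta 2 j 4⁻¹`), along the printed proof (§§3–7: the linear forms
`T_n = ∫_{ℤ₂}B_n^{(s)}(t+¼)dt`, their arithmetic, Archimedean and `2`-adic sizes, and Lemma 2.1).
[cite: Lai2025TwoAdicZeta, Thm 1.3 (§1) and §7 (proof)] -/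
theorem lai2025TwoAdic_theorem13_holds : lai2025TwoAdic_theorem13 := by
  intro s
  obtain ⟨i, hi⟩ := exists_isIrrational_window s
  have hi2 := mem_Icc.1 i.2
  exact ⟨(i : ℕ) + s + 1, by omega, by omega, hi⟩

end Literature.NumberTheory.Irrationality.PAdicZetaValues
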